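import Literature.AlgebraicGeometry.Modules.FinitePresentationLocal
import Literature.AlgebraicGeometry.Modules.VectorBundleFiniteLocallyFree
import HarnessLib

/-!
# Cokernels of morphisms of vector bundles are finitely presented

The Stacks Project, Tag 01BN (Modules of finite presentation, Section 17.11): an `𝒪_X`-module is of
finite presentation if locally it is the cokernel of a morphism of finite free modules,
`⊕_{j} 𝒪_U → ⊕_{i} 𝒪_U → 𝓕|_U → 0` with finite index sets; Tag 01BP: "(3) Any finite locally free
`𝒪_X`-module is of finite presentation."  Hence the cokernel of a morphism `u : V' → V` of finite
locally free modules is finitely presented: near every point both `V'` and `V` are free of finite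
rank on a common open `W`, restriction to `W` is exact, and `(coker u)|_W ≅ coker (𝒪_Wᴷ → 𝒪_Wᴵ)`
is literally such a cokernel.

In the tree's vocabulary (`IsVectorBundle` = Mathlib `IsLocallyFree ∧ IsFiniteType`, equivalently
`IsFiniteLocallyFree`; Mathlib `SheafOfModules.IsFinitePresentation` on `Scheme.Modules`):

* `nonempty_presentation_cokernel_of_free_iso` — on a scheme `W`, the cokernel of `u : V' → V` with
  `𝒪ᴷ ≅ V'`, `𝒪ᴵ ≅ V` (`K`, `I` finite) has a finite global presentation
  (Mathlib `presentationOfIsCokernelFree`);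
* `isFinitePresentation_cokernel_of_isVectorBundle` — **the cokernel of a morphism of vector bundles
  is finitely presented**;
* `isFinitePresentation_of_isVectorBundle` — **a vector bundle is finitely presented** (Tag 01BP (3);
  the case `u = 0`).

Everything is proved; no named facts. Mathlib searched (pin v4.32): `SheafOfModules.presentationOfIsCokernelFree`,
`PreservesCokernel.iso`, `cokernel.mapIso`, `Presentation.ofIsIso`, `cokernelZeroIsoTarget` (used);
Mathlib has no finite-presentation statement for locally free modules or cokernels.

## References

* The Stacks Project, Tags 01BN, 01BP (modules of finite presentation; finite locally free ⇒ finite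
  presentation). [StacksProject]
-/

universe u

open CategoryTheory CategoryTheory.Limits AlgebraicGeometry TopologicalSpace Opposite
open Literature.AlgebraicGeometry.Motives Literature.AlgebraicGeometry.KTheory

namespace Literature.AlgebraicGeometry.Modules

variable {X : Scheme.{u}}

set_option backward.isDefEq.respectTransparency false in
/-- **A cokernel of a morphism between free modules of finite rank has a finite global presentation**:
if `𝒪ᴷ ≅ V'` and `𝒪ᴵ ≅ V` with `K`, `I` finite, then `coker (u : V' → V) ≅ coker (𝒪ᴷ → 𝒪ᴵ)` carries
Mathlib's `presentationOfIsCokernelFree`. [cite: StacksProject, Tag 01BN] -/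
theorem nonempty_presentation_cokernel_of_free_iso {V V' : X.Modules} (u : V' ⟶ V)
    {I K : Type u} [Finite I] [Finite K] (eV : SheafOfModules.free I ≅ V)
    (eV' : SheafOfModules.free K ≅ V') :
    ∃ P : SheafOfModules.Presentation (cokernel u), P.IsFinite := by
  let u' : SheafOfModules.free (R := X.ringCatSheaf) K ⟶ SheafOfModules.free I :=
    eV'.hom ≫ u ≫ eV.inv
  let e : cokernel u' ≅ cokernel u :=
    cokernel.mapIso u' u eV' eV (by simp only [u', Category.assoc, Iso.inv_hom_id, Category.comp_id])
  let P₀ : SheafOfModules.Presentation (cokernel u') :=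
    SheafOfModules.presentationOfIsCokernelFree u' (cokernel.π u') (cokernel.condition u')
      (cokernelIsCokernel u')
  haveI : P₀.IsFinite :=
    { isFiniteType_generators := ⟨by
        change Finite I
        infer_instance⟩
      isFiniteType_relations := ⟨by
        change Finite K
        infer_instance⟩ }
  exact ⟨P₀.ofIsIso e.hom, inferInstance⟩

set_option backward.isDefEq.respectTransparency false in
/-- **The cokernel of a morphism of vector bundles is finitely presented** (Stacks 01BN/01BP): near
each point trivialise `V'` and `V` on a common open `W`; restriction to `W` preserves cokernels, so
`(coker u)|_W ≅ coker (𝒪_Wᴷ → 𝒪_Wᴵ)` has a finite presentation, and finite presentation is local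
(tree `isFinitePresentation_of_isOpenCover`). [cite: StacksProject, Tag 01BP] -/
theorem isFinitePresentation_cokernel_of_isVectorBundle {V V' : X.Modules} (u : V' ⟶ V)
    (hV : IsVectorBundle V) (hV' : IsVectorBundle V') :
    SheafOfModules.IsFinitePresentation.{u, u, u} (cokernel u) := by
  -- a common trivialising open `W x ∋ x` for `V` and `V'`
  have hW : ∀ x : X, ∃ W : X.Opens, x ∈ W ∧
      ∃ P : SheafOfModules.Presentation ((cokernel u).restrict W.ι), P.IsFinite := by
    intro x
    obtain ⟨U₁, hx₁, I, hI, ⟨e₁⟩⟩ := hV.isFiniteLocallyFree x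
    obtain ⟨U₂, hx₂, K, hK, ⟨e₂⟩⟩ := hV'.isFiniteLocallyFree x
    let W : X.Opens := U₁ ⊓ U₂
    obtain ⟨f₁⟩ := nonempty_restrictIso_of_overIso
      (SheafOfModules.restrictTrivialisation (R := X.ringCatSheaf) (homOfLE inf_le_left) e₁)
    obtain ⟨f₂⟩ := nonempty_restrictIso_of_overIso
      (SheafOfModules.restrictTrivialisation (R := X.ringCatSheaf) (homOfLE inf_le_right) e₂)
    -- restriction to `W` preserves the cokernel
    let Rf := Scheme.Modules.restrictFunctor W.ι
    haveI : PreservesColimitsOfSize.{u, u} Rf := inferInstance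
    let ec : (cokernel u).restrict W.ι ≅ cokernel (Rf.map u) := PreservesCokernel.iso Rf u
    obtain ⟨P, hP⟩ := nonempty_presentation_cokernel_of_free_iso (Rf.map u) f₁ f₂
    haveI := hP
    exact ⟨W, ⟨hx₁, hx₂⟩, P.ofIsIso ec.inv, inferInstance⟩
  choose W hxW P hP using hW
  haveI := hP
  exact isFinitePresentation_of_presentations (cokernel u) W
    (IsOpenCover.mk (eq_top_iff.2 fun x _ => Opens.mem_iSup.2 ⟨x, hxW x⟩)) P

/-- **A vector bundle is finitely presented** (The Stacks Project, Tag 01BP (3): "Any finite locally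
free `𝒪_X`-module is of finite presentation"): `V ≅ coker (0 : V → V)`.
[cite: StacksProject, Tag 01BP] -/
theorem isFinitePresentation_of_isVectorBundle {V : X.Modules} (hV : IsVectorBundle V) :
    SheafOfModules.IsFinitePresentation.{u, u, u} V :=
  isFinitePresentation_of_iso (cokernelZeroIsoTarget (X := V) (Y := V))
    (isFinitePresentation_cokernel_of_isVectorBundle (0 : V ⟶ V) hV hV)

end Literature.AlgebraicGeometry.Modules
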